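import Literature.Barriers.QuantumAdvantage.UncorrectedNoise
import Literature.Computability.Complexity.BooleanFourier
import Literature.Computability.QuantumComplexity.ExactBosonSamplingHardness
import HarnessLib

/-!
# Uncorrected noise, Fourier side: bit-flip noise damps Walsh coefficients; truncation and marginals

Support file for the discharge of `bremnerMontanaroShepherd2017_thm4`
(`Literature/Barriers/QuantumAdvantage/UncorrectedNoise.lean`), following §3 of
Bremner–Montanaro–Shepherd 2017. Everything here is finite Fourier–Walsh analysis on the cube
`{0,1}^N = (Fin N → Bool)` with the coefficients `cubeFourierCoeff` of
`Literature/Computability/Complexity/BooleanFourier.lean` (normalisation `ĝ(S) = 2^{-N} Σ_x g(x) χ_S(x)`,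
the paper's), and is fully proved (`PMF.map` along an injective map is evaluated with
`pmf_map_apply_of_injective` of `QuantumComplexity/ExactBosonSamplingHardness.lean`, reused):

* `bxor`, `flipWeight η e = ∏ᵢ (η if eᵢ else 1-η)` (`= η^{|e|}(1-η)^{N-|e|}`), the noise operator
  `noiseOp η g x = Σ_e flipWeight η e · g(x ⊕ e)` (independent bit flips with probability `η`);
* **noise damping** `cubeFourierCoeff_noiseOp`: `(noiseOp η g)^(S) = (1-2η)^{|S|} ĝ(S)`
  [BMS17 §3, "`\hat{\tilde p}(s) = (1-ε)^{|s|} \hat p(s)`" with `ε = 2η`; O'Donnell 2014 Prop. 2.47];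
* the link with the tree's list-level noise `flipBits`/`SamplingProblem.withBitFlips` of
  `UncorrectedNoise.lean`: `flipBits η (ofFn y) = (noisePMF η y).map ofFn` and
  `withBitFlips` of a push-forward `μ.map ofFn` is the push-forward of `μ.bind noisePMF`, whose
  masses are `noiseOp η (μ ·) w` (`toReal_bind_noisePMF_apply`);
* Fourier synthesis `fourierFn c = Σ_S c_S χ_S` and uniqueness of coefficients;
* the **`ℓ₁`/`ℓ₂`/Parseval truncation estimate** of §3.1 (`l1_sq_le_card_mul_l2_sq`,
  `truncation_l1_sq_le`);
* the **marginal formula** of §3.1 (`prefixSum_fourierFn`): for `q = Σ_S c_S χ_S` and a prefix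
  `y ∈ {0,1}^k`, `Σ_{x ⊒ y} q(x) = 2^{N-k} Σ_{S ⊆ [k]} c_S χ_S(y)`.

## References

* [BremnerMontanaroShepherd2017] M. J. Bremner, A. Montanaro, D. J. Shepherd, *Achieving quantum
  supremacy with sparse and noisy commuting quantum computations*, Quantum 1 (2017) 8, §3, §3.1.
* [ODonnell2014] R. O'Donnell, *Analysis of Boolean Functions*, CUP 2014, §1.4 (Parseval), §2.4
  (noise operator, Prop. 2.47), §3.3.
-/

noncomputable section

namespace Literature.Barriers.QuantumAdvantage

open Finset
open scoped NNReal ENNReal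
open Literature.Probability.RandomGraphs.LowDegree (sgn walsh sgn_true sgn_false)
open Literature.Computability.Complexity.LowDegree (cubeFourierCoeff)

variable {N : ℕ}

/-! ### Points of the cube: xor, flip weights, the noise operator -/

/-- Bitwise xor of two points of the cube `{0,1}^N`. [folklore] -/
def bxor (x e : Fin N → Bool) : Fin N → Bool := fun i => x i ^^ e i

/-- `x ⊕ e ⊕ e = x`. [folklore] -/
@[simp] theorem bxor_bxor_cancel (x e : Fin N → Bool) : bxor (bxor x e) e = x := by
  funext i; simp [bxor]

/-- `bxor` is commutative. [folklore] -/
theorem bxor_comm (x e : Fin N → Bool) : bxor x e = bxor e x := by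
  funext i; simp [bxor, Bool.xor_comm]

/-- `y ⊕ (y ⊕ w) = w`. [folklore] -/
@[simp] theorem bxor_bxor_cancel_left (y w : Fin N → Bool) : bxor y (bxor y w) = w := by
  funext i; simp [bxor]

/-- `x ⊕ x = 0`. [folklore] -/
@[simp] theorem bxor_self (x : Fin N → Bool) : bxor x x = fun _ => false := by
  funext i; simp [bxor]

/-- `x ⊕ 0 = x`. [folklore] -/
@[simp] theorem bxor_zero (x : Fin N → Bool) : bxor x (fun _ => false) = x := by
  funext i; simp [bxor]

/-- `(x ⊕ e) ⊕ (y ⊕ e) = x ⊕ y`. [folklore] -/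
@[simp] theorem bxor_bxor_bxor_cancel (x y e : Fin N → Bool) : bxor (bxor x e) (bxor y e) = bxor x y := by
  funext i; simp only [bxor]; cases x i <;> cases y i <;> cases e i <;> rfl

/-- Translation by `e` is an involution of the cube (as an `Equiv`). [folklore] -/
def bxorEquiv (e : Fin N → Bool) : (Fin N → Bool) ≃ (Fin N → Bool) where
  toFun x := bxor x e
  invFun x := bxor x e
  left_inv x := bxor_bxor_cancel x e
  right_inv x := bxor_bxor_cancel x e

/-- A character at a translated point: `χ_S(x ⊕ e) = χ_S(x) χ_S(e)`. [cite: ODonnell2014, §1.4] -/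
theorem walsh_bxor (S : Finset (Fin N)) (x e : Fin N → Bool) :
    walsh S (bxor x e) = walsh S x * walsh S e := by
  unfold walsh
  rw [← Finset.prod_mul_distrib]
  refine Finset.prod_congr rfl fun i _ => ?_
  simp only [bxor]
  cases x i <;> cases e i <;> simp [sgn]

/-- The probability of the flip pattern `e` under independent bit flips with probability `η`:
`∏ᵢ (η if eᵢ = 1 else 1 - η) = η^{|e|} (1-η)^{N-|e|}`. [cite: BremnerMontanaroShepherd2017, §1 (noise model: "Pr[e = e'] = (ε/2)^{|e'|}(1-ε/2)^{n-|e'|}")] -/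
def flipWeight (η : ℝ) (e : Fin N → Bool) : ℝ := ∏ i, if e i = true then η else 1 - η

/-- Closed form `flipWeight η e = η^{|e|} (1-η)^{N-|e|}`, `|e|` the Hamming weight.
[cite: BremnerMontanaroShepherd2017, §1] -/
theorem flipWeight_eq_pow (η : ℝ) (e : Fin N → Bool) :
    flipWeight η e = η ^ (univ.filter fun i => e i = true).card *
      (1 - η) ^ (N - (univ.filter fun i => e i = true).card) := by
  unfold flipWeight
  rw [Finset.prod_ite, Finset.prod_const, Finset.prod_const]
  congr 2
  have h := Finset.card_filter_add_card_filter_not (s := (univ : Finset (Fin N)))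
    (fun i => e i = true)
  simp only [Finset.card_univ, Fintype.card_fin] at h
  omega

/-- The flip weights are nonnegative for `0 ≤ η ≤ 1`. [folklore] -/
theorem flipWeight_nonneg {η : ℝ} (h0 : 0 ≤ η) (h1 : η ≤ 1) (e : Fin N → Bool) : 0 ≤ flipWeight η e :=
  Finset.prod_nonneg fun i _ => by split_ifs <;> linarith

/-- The flip weights sum to one. [folklore] -/
theorem sum_flipWeight (η : ℝ) : ∑ e : Fin N → Bool, flipWeight η e = 1 := by
  unfold flipWeight
  rw [← Fintype.prod_sum (fun (_ : Fin N) (b : Bool) => if b = true then η else 1 - η)]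
  simp

/-- **The noise operator** (binary symmetric channel with flip probability `η` on each bit):
`(noiseOp η g)(x) = Σ_e flipWeight η e · g(x ⊕ e)`; for a probability vector `g = p` this is the
distribution of "sample `x ∼ p`, then flip each bit independently with probability `η`".
[cite: BremnerMontanaroShepherd2017, §3 (the noise operator 𝒩_ε)] -/
def noiseOp (η : ℝ) (g : (Fin N → Bool) → ℝ) (x : Fin N → Bool) : ℝ :=
  ∑ e, flipWeight η e * g (bxor x e)

/-- The generating identity of the flip weights against a character:
`Σ_e flipWeight η e χ_S(e) = (1 - 2η)^{|S|}`. [cite: ODonnell2014, §2.4] -/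
theorem sum_flipWeight_mul_walsh (η : ℝ) (S : Finset (Fin N)) :
    ∑ e : Fin N → Bool, flipWeight η e * walsh S e = (1 - 2 * η) ^ S.card := by
  classical
  have key : ∀ e : Fin N → Bool, flipWeight η e * walsh S e =
      ∏ i, ((if e i = true then η else 1 - η) * (if i ∈ S then sgn (e i) else 1)) := by
    intro e
    rw [flipWeight, Literature.Computability.Complexity.LowDegree.walsh_eq_prod_ite,
      ← Finset.prod_mul_distrib]
  simp_rw [key]
  rw [← Fintype.prod_sum (fun (i : Fin N) (b : Bool) =>
    (if b = true then η else 1 - η) * (if i ∈ S then sgn b else 1))]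
  rw [← Finset.prod_filter_mul_prod_filter_not univ (fun i => i ∈ S)]
  have h1 : ∏ i ∈ univ.filter (fun i => i ∈ S),
      ∑ b : Bool, (if b = true then η else 1 - η) * (if i ∈ S then sgn b else 1) = (1 - 2 * η) ^ S.card := by
    rw [Finset.prod_congr rfl (g := fun _ => 1 - 2 * η), Finset.prod_const]
    · congr 1
      rw [Finset.filter_mem_eq_inter, Finset.univ_inter]
    · intro i hi
      rw [Finset.mem_filter] at hi
      simp [hi.2]
      ring
  have h2 : ∏ i ∈ univ.filter (fun i => ¬ i ∈ S),
      ∑ b : Bool, (if b = true then η else 1 - η) * (if i ∈ S then sgn b else 1) = 1 := by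
    refine Finset.prod_eq_one fun i hi => ?_
    rw [Finset.mem_filter] at hi
    simp [hi.2]
  rw [h1, h2, mul_one]

/-- **Noise damps the Fourier–Walsh coefficients geometrically in the degree**:
`(noiseOp η g)^(S) = (1 - 2η)^{|S|} ĝ(S)`. With `η = ε/2` this is
`\hat{\tilde p}(s) = (1-ε)^{|s|} \hat p(s)`. [cite: BremnerMontanaroShepherd2017, §3 (display before §3.1)] -/
theorem cubeFourierCoeff_noiseOp (η : ℝ) (g : (Fin N → Bool) → ℝ) (S : Finset (Fin N)) :
    cubeFourierCoeff (noiseOp η g) S = (1 - 2 * η) ^ S.card * cubeFourierCoeff g S := by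
  unfold cubeFourierCoeff noiseOp
  rw [← sum_flipWeight_mul_walsh η S, mul_div_assoc']
  congr 1
  calc ∑ x : Fin N → Bool, (∑ e, flipWeight η e * g (bxor x e)) * walsh S x
      = ∑ e : Fin N → Bool, flipWeight η e * ∑ x, g (bxor x e) * walsh S x := by
        simp_rw [Finset.sum_mul, Finset.mul_sum]
        rw [Finset.sum_comm]
        refine Finset.sum_congr rfl fun e _ => Finset.sum_congr rfl fun x _ => ?_
        ring
    _ = ∑ e : Fin N → Bool, flipWeight η e * (walsh S e * ∑ x, g x * walsh S x) := by
        refine Finset.sum_congr rfl fun e _ => ?_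
        congr 1
        rw [Finset.mul_sum]
        -- reindex `x ↦ x ⊕ e`
        rw [← Equiv.sum_comp (bxorEquiv e) (fun x => g (bxor x e) * walsh S x)]
        refine Finset.sum_congr rfl fun x _ => ?_
        simp only [bxorEquiv, Equiv.coe_fn_mk, bxor_bxor_cancel, walsh_bxor]
        ring
    _ = (∑ e : Fin N → Bool, flipWeight η e * walsh S e) * ∑ x, g x * walsh S x := by
        rw [Finset.sum_mul]
        refine Finset.sum_congr rfl fun e _ => ?_
        ring

/-! ### The list-level noise `flipBits` is the cube noise pushed along `List.ofFn` -/

/-- The flip weights in `ℝ≥0` (for the `PMF` bookkeeping). [folklore] -/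
def flipWeightNN (η : ℝ≥0) (e : Fin N → Bool) : ℝ≥0 := ∏ i, if e i = true then η else 1 - η

/-- For `η ≤ 1` the `ℝ≥0` flip weight is the real flip weight. [folklore] -/
theorem coe_flipWeightNN {η : ℝ≥0} (hη : η ≤ 1) (e : Fin N → Bool) :
    (flipWeightNN η e : ℝ) = flipWeight (η : ℝ) e := by
  unfold flipWeightNN flipWeight
  push_cast
  refine Finset.prod_congr rfl fun i _ => ?_
  split_ifs
  · rfl
  · rw [NNReal.coe_sub hη, NNReal.coe_one]

/-- The `ℝ≥0` flip weights sum to one (`η ≤ 1`). [folklore] -/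
theorem sum_flipWeightNN {η : ℝ≥0} (hη : η ≤ 1) : ∑ e : Fin N → Bool, flipWeightNN η e = 1 := by
  unfold flipWeightNN
  rw [← Fintype.prod_sum (fun (_ : Fin N) (b : Bool) => if b = true then η else 1 - η)]
  simp [add_tsub_cancel_of_le hη]

/-- **The cube-level noise kernel**: starting from `y`, the string `w` is produced with
probability `flipWeight η (y ⊕ w)`. [cite: BremnerMontanaroShepherd2017, §1 (noise model)] -/
def noisePMF (η : ℝ≥0) (hη : η ≤ 1) (y : Fin N → Bool) : PMF (Fin N → Bool) :=
  PMF.ofFintype (fun w => (flipWeightNN η (bxor y w) : ℝ≥0∞)) (by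
    rw [← ENNReal.ofNNReal_finsetSum, ENNReal.coe_eq_one]
    rw [← Equiv.sum_comp (bxorEquiv y) (fun w => flipWeightNN η (bxor y w))]
    have h : ∀ w, flipWeightNN η (bxor y ((bxorEquiv y) w)) = flipWeightNN η w := by
      intro w
      simp only [bxorEquiv, Equiv.coe_fn_mk]
      rw [bxor_comm w y, bxor_bxor_cancel_left]
    simp_rw [h]
    exact sum_flipWeightNN hη)

/-- Masses of the cube-level noise kernel. [folklore] -/
@[simp] theorem noisePMF_apply (η : ℝ≥0) (hη : η ≤ 1) (y w : Fin N → Bool) :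
    noisePMF η hη y w = (flipWeightNN η (bxor y w) : ℝ≥0∞) := by
  simp [noisePMF, PMF.ofFintype_apply]

/-- `PMF.map` vanishes off the range of the map. [folklore] -/
theorem pmfMap_apply_of_not_mem_range {α β : Type*} (p : PMF α) (f : α → β) {b : β}
    (hb : b ∉ Set.range f) : (p.map f) b = 0 := by
  rw [PMF.map_apply, ENNReal.tsum_eq_zero]
  intro a
  rw [if_neg]
  rintro rfl
  exact hb ⟨a, rfl⟩

/-- The biased coin does not flip with probability `1 - η`. [cite: BremnerMontanaroShepherd2017, §1] -/
@[simp] theorem biasedCoin_apply_false (η : ℝ≥0) (hη : η ≤ 1) : biasedCoin η hη false = (1 - η : ℝ≥0) := by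
  simp [biasedCoin, PMF.ofFintype_apply]

/-- The biased coin at `c` has mass `η` or `1 - η`. [folklore] -/
theorem biasedCoin_apply (η : ℝ≥0) (hη : η ≤ 1) (c : Bool) :
    biasedCoin η hη c = ((if c = true then η else 1 - η : ℝ≥0) : ℝ≥0∞) := by
  cases c <;> simp

/-- One step of the cube noise: flip the first bit with the coin, the rest recursively.
[cite: BremnerMontanaroShepherd2017, §1 (independent flips)] -/
theorem noisePMF_succ (η : ℝ≥0) (hη : η ≤ 1) (y : Fin (N + 1) → Bool) :
    noisePMF η hη y = (biasedCoin η hη).bind fun c =>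
      (noisePMF η hη (Fin.tail y)).map (Fin.cons (y 0 ^^ c)) := by
  refine PMF.ext fun w => ?_
  rw [PMF.bind_apply, tsum_fintype, noisePMF_apply]
  have hcons : ∀ c : Bool, ((noisePMF η hη (Fin.tail y)).map (Fin.cons (y 0 ^^ c))) w =
      if w 0 = (y 0 ^^ c) then (flipWeightNN η (bxor (Fin.tail y) (Fin.tail w)) : ℝ≥0∞) else 0 := by
    intro c
    split_ifs with h
    · have hw : w = Fin.cons (y 0 ^^ c) (Fin.tail w) := by rw [← h, Fin.cons_self_tail]
      conv_lhs => rw [hw]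
      rw [Literature.Computability.QuantumComplexity.pmf_map_apply_of_injective _ (Fin.cons_right_injective _),
        noisePMF_apply]
    · apply pmfMap_apply_of_not_mem_range
      rintro ⟨w', hw'⟩
      apply h
      rw [← hw', Fin.cons_zero]
  simp_rw [hcons, biasedCoin_apply]
  rw [Fintype.sum_bool]
  have key : (flipWeightNN η (bxor y w) : ℝ≥0∞) =
      ((if (y 0 ^^ w 0) = true then η else 1 - η : ℝ≥0) : ℝ≥0∞) *
        (flipWeightNN η (bxor (Fin.tail y) (Fin.tail w)) : ℝ≥0∞) := by
    rw [← ENNReal.coe_mul, ENNReal.coe_inj, flipWeightNN, flipWeightNN, Fin.prod_univ_succ]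
    rfl
  rw [key]
  cases hy : y 0 <;> cases hw : w 0 <;> simp

/-- **`flipBits` is the cube noise read through `List.ofFn`**: flipping the bits of the list
`ofFn y` independently gives the list `ofFn w` with probability `flipWeight η (y ⊕ w)`.
[cite: BremnerMontanaroShepherd2017, §1 (noise model)] -/
theorem flipBits_ofFn (η : ℝ≥0) (hη : η ≤ 1) :
    ∀ {N : ℕ} (y : Fin N → Bool), flipBits η hη (List.ofFn y) = (noisePMF η hη y).map List.ofFn
  | 0, y => by
    rw [List.ofFn_zero, flipBits_nil]
    have h : (List.ofFn : (Fin 0 → Bool) → List Bool) = Function.const _ [] := by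
      funext w; rw [List.ofFn_zero]; rfl
    rw [h, PMF.map_const]
  | N + 1, y => by
    rw [List.ofFn_succ, flipBits, noisePMF_succ, PMF.map_bind]
    congr 1
    funext c
    rw [flipBits_ofFn η hη (fun i => y i.succ), PMF.map_comp, PMF.map_comp]
    congr 1
    funext w
    simp only [Function.comp_apply, List.ofFn_succ, Fin.cons_zero, Fin.cons_succ]

/-- **The noisy version of a distribution on `{0,1}^N` read as strings**: adding bit-flip noise to
`μ.map ofFn` is pushing `μ.bind (noisePMF η)` along `ofFn`.
[cite: BremnerMontanaroShepherd2017, §1 (the distribution p̃)] -/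
theorem map_ofFn_bind_flipBits (η : ℝ≥0) (hη : η ≤ 1) (μ : PMF (Fin N → Bool)) :
    (μ.map List.ofFn).bind (flipBits η hη) = (μ.bind (noisePMF η hη)).map List.ofFn := by
  rw [PMF.bind_map, PMF.map_bind]
  congr 1
  funext y
  exact flipBits_ofFn η hη y

/-- Masses of `μ.bind (noisePMF η)`: the noise operator applied to the probability vector of `μ`,
`(μ ⋆ noise)(w) = Σ_e flipWeight η e · μ(w ⊕ e) = noiseOp η μ w`.
[cite: BremnerMontanaroShepherd2017, §3 (p̃ = 𝒩_ε p)] -/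
theorem toReal_bind_noisePMF_apply {η : ℝ≥0} (hη : η ≤ 1) (μ : PMF (Fin N → Bool)) (w : Fin N → Bool) :
    ((μ.bind (noisePMF η hη)) w).toReal = noiseOp (η : ℝ) (fun y => (μ y).toReal) w := by
  rw [PMF.bind_apply, tsum_fintype, ENNReal.toReal_sum (fun y _ =>
    ENNReal.mul_ne_top (PMF.apply_ne_top μ y) (by rw [noisePMF_apply]; exact ENNReal.coe_ne_top))]
  unfold noiseOp
  rw [← Equiv.sum_comp (bxorEquiv w) (fun y => (μ y * noisePMF η hη y w).toReal)]
  refine Finset.sum_congr rfl fun e _ => ?_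
  simp only [bxorEquiv, Equiv.coe_fn_mk, noisePMF_apply]
  rw [ENNReal.toReal_mul, ENNReal.coe_toReal, coe_flipWeightNN hη, mul_comm]
  rw [bxor_bxor_cancel, bxor_comm]

/-! ### Fourier synthesis, `ℓ₁` versus `ℓ₂`, and the truncation estimate of §3.1 -/

/-- Fourier synthesis: the real function on the cube with Walsh coefficients `c`,
`fourierFn c = Σ_S c_S χ_S`. [cite: ODonnell2014, Thm 1.1] -/
def fourierFn (c : Finset (Fin N) → ℝ) (x : Fin N → Bool) : ℝ := ∑ S, c S * walsh S x

/-- The coefficients of a synthesised function are the prescribed ones (uniqueness of the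
Fourier–Walsh expansion). [cite: ODonnell2014, Thm 1.1] -/
theorem cubeFourierCoeff_fourierFn (c : Finset (Fin N) → ℝ) (S : Finset (Fin N)) :
    cubeFourierCoeff (fourierFn c) S = c S := by
  unfold cubeFourierCoeff fourierFn
  have h2 : (2 : ℝ) ^ N ≠ 0 := by positivity
  rw [div_eq_iff h2]
  calc ∑ x : Fin N → Bool, (∑ T, c T * walsh T x) * walsh S x
      = ∑ T, c T * ∑ x : Fin N → Bool, walsh T x * walsh S x := by
        simp_rw [Finset.sum_mul]
        rw [Finset.sum_comm]
        refine Finset.sum_congr rfl fun T _ => ?_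
        rw [Finset.mul_sum]
        refine Finset.sum_congr rfl fun x _ => ?_
        ring
    _ = c S * 2 ^ N := by
        simp_rw [Literature.Computability.Complexity.LowDegree.sum_walsh_mul_walsh_index, mul_ite,
          mul_zero]
        rw [Finset.sum_ite_eq' univ S]
        simp

/-- Every real function on the cube is the synthesis of its coefficients (Fourier inversion).
[cite: ODonnell2014, Thm 1.1] -/
theorem fourierFn_cubeFourierCoeff (g : (Fin N → Bool) → ℝ) : fourierFn (cubeFourierCoeff g) = g := by
  funext x
  exact Literature.Computability.Complexity.LowDegree.sum_cubeFourierCoeff_mul_walsh g x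

/-- Coefficients are linear: `(u - v)^ = û - v̂`. [cite: ODonnell2014, §1.2] -/
theorem cubeFourierCoeff_sub (u v : (Fin N → Bool) → ℝ) (S : Finset (Fin N)) :
    cubeFourierCoeff (fun x => u x - v x) S = cubeFourierCoeff u S - cubeFourierCoeff v S := by
  unfold cubeFourierCoeff
  rw [← sub_div, ← Finset.sum_sub_distrib]
  congr 1
  refine Finset.sum_congr rfl fun x _ => ?_
  ring

/-- **`ℓ₁ ≤ √(2^N) ℓ₂`** on the cube (Cauchy–Schwarz): `(Σ_x |u x|)² ≤ 2^N Σ_x u(x)²`.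
[cite: BremnerMontanaroShepherd2017, §3.1 (first display: bounding the ℓ₁ norm by the ℓ₂ norm)] -/
theorem l1_sq_le_card_mul_l2_sq (u : (Fin N → Bool) → ℝ) :
    (∑ x, |u x|) ^ 2 ≤ 2 ^ N * ∑ x, u x ^ 2 := by
  have h := Finset.sum_mul_sq_le_sq_mul_sq (univ : Finset (Fin N → Bool)) (fun _ => (1 : ℝ)) (fun x => |u x|)
  simp only [one_mul, one_pow, Finset.sum_const, Finset.card_univ, Fintype.card_fun, Fintype.card_bool,
    Fintype.card_fin, nsmul_eq_mul, mul_one, sq_abs] at h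
  push_cast at h
  exact h

/-- **`ℓ₁` in terms of coefficients** (Cauchy–Schwarz and Parseval):
`(Σ_x |u x|)² ≤ 2^{2N} Σ_S û(S)²`. [cite: BremnerMontanaroShepherd2017, §3.1 (first display)] -/
theorem l1_sq_le_sum_cubeFourierCoeff_sq (u : (Fin N → Bool) → ℝ) :
    (∑ x, |u x|) ^ 2 ≤ 2 ^ (2 * N) * ∑ S, cubeFourierCoeff u S ^ 2 := by
  rw [Literature.Computability.Complexity.LowDegree.sum_cubeFourierCoeff_sq, two_mul, pow_add,
    mul_assoc, mul_div_cancel₀ _ (by positivity : (2 : ℝ) ^ N ≠ 0)]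
  exact l1_sq_le_card_mul_l2_sq u

/-- **The truncation estimate of §3.1.** For a probability vector `p` (any real function), noise
rate `η ∈ [0, 1]` and a synthesised `q̃ = Σ_{|S| ≤ ℓ} c_S χ_S` supported in degree `≤ ℓ`,
`‖q̃ − 𝒩p‖₁² ≤ 2^{2N} Σ_{|S| ≤ ℓ} (c_S − (1−2η)^{|S|} p̂(S))² + (1−2η)^{2(ℓ+1)} · 2^N Σ_x p(x)²`
(the paper continues with `|c_S − (1−2η)^{|S|}p̂(S)| ≤ γ2^{-N}` and `Σ p² ≤ α2^{-N}`).
[cite: BremnerMontanaroShepherd2017, §3.1 (displays 1–2)] -/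
theorem truncation_l1_sq_le (p : (Fin N → Bool) → ℝ) {η : ℝ} (h0 : 0 ≤ η) (h1 : η ≤ 1) (ℓ : ℕ)
    (c : Finset (Fin N) → ℝ) (hc : ∀ S, ℓ < S.card → c S = 0) :
    (∑ x, |fourierFn c x - noiseOp η p x|) ^ 2 ≤
      2 ^ (2 * N) * ∑ S ∈ univ.filter (fun S : Finset (Fin N) => S.card ≤ ℓ),
          (c S - (1 - 2 * η) ^ S.card * cubeFourierCoeff p S) ^ 2 +
        ((1 - 2 * η) ^ 2) ^ (ℓ + 1) * 2 ^ N * ∑ x, p x ^ 2 := by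
  have hρ0 : 0 ≤ (1 - 2 * η) ^ 2 := sq_nonneg _
  have hρ1 : (1 - 2 * η) ^ 2 ≤ 1 := by nlinarith
  refine (l1_sq_le_sum_cubeFourierCoeff_sq _).trans ?_
  have hcoef : ∀ S : Finset (Fin N), cubeFourierCoeff (fun x => fourierFn c x - noiseOp η p x) S =
      c S - (1 - 2 * η) ^ S.card * cubeFourierCoeff p S := by
    intro S
    rw [cubeFourierCoeff_sub, cubeFourierCoeff_fourierFn, cubeFourierCoeff_noiseOp]
  simp_rw [hcoef]
  rw [← Finset.sum_filter_add_sum_filter_not univ (fun S : Finset (Fin N) => S.card ≤ ℓ), mul_add]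
  refine add_le_add le_rfl ?_
  have htail : ∀ S ∈ univ.filter (fun S : Finset (Fin N) => ¬ S.card ≤ ℓ),
      (c S - (1 - 2 * η) ^ S.card * cubeFourierCoeff p S) ^ 2 ≤
        ((1 - 2 * η) ^ 2) ^ (ℓ + 1) * cubeFourierCoeff p S ^ 2 := by
    intro S hS
    rw [Finset.mem_filter] at hS
    have hlt : ℓ < S.card := not_le.mp hS.2
    rw [hc S hlt, zero_sub, neg_sq, mul_pow, ← pow_mul, mul_comm S.card 2, pow_mul]
    refine mul_le_mul_of_nonneg_right ?_ (sq_nonneg _)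
    exact pow_le_pow_of_le_one hρ0 hρ1 hlt
  calc 2 ^ (2 * N) * ∑ S ∈ univ.filter (fun S : Finset (Fin N) => ¬ S.card ≤ ℓ),
        (c S - (1 - 2 * η) ^ S.card * cubeFourierCoeff p S) ^ 2
      ≤ 2 ^ (2 * N) * ∑ S ∈ univ.filter (fun S : Finset (Fin N) => ¬ S.card ≤ ℓ),
        ((1 - 2 * η) ^ 2) ^ (ℓ + 1) * cubeFourierCoeff p S ^ 2 :=
        mul_le_mul_of_nonneg_left (Finset.sum_le_sum htail) (by positivity)
    _ ≤ 2 ^ (2 * N) * ∑ S, ((1 - 2 * η) ^ 2) ^ (ℓ + 1) * cubeFourierCoeff p S ^ 2 := by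
        refine mul_le_mul_of_nonneg_left ?_ (by positivity)
        refine Finset.sum_le_sum_of_subset_of_nonneg (Finset.filter_subset _ _) fun S _ _ => ?_
        positivity
    _ = ((1 - 2 * η) ^ 2) ^ (ℓ + 1) * 2 ^ N * ∑ x, p x ^ 2 := by
        rw [← Finset.mul_sum, Literature.Computability.Complexity.LowDegree.sum_cubeFourierCoeff_sq,
          two_mul, pow_add]
        field_simp

/-! ### Prefix sums (marginals) of a synthesised function, §3.1 -/

/-- The sub-cube of points agreeing with `y` on the first `k` coordinates (as a `piFinset`).
[folklore] -/
def prefixCube (k : ℕ) (y : ℕ → Bool) : Finset (Fin N → Bool) :=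
  Fintype.piFinset fun i : Fin N => if (i : ℕ) < k then {y i} else univ

/-- Membership in the prefix sub-cube. [folklore] -/
theorem mem_prefixCube {k : ℕ} {y : ℕ → Bool} {x : Fin N → Bool} :
    x ∈ prefixCube k y ↔ ∀ i : Fin N, (i : ℕ) < k → x i = y i := by
  unfold prefixCube
  rw [Fintype.mem_piFinset]
  refine forall_congr' fun i => ?_
  by_cases h : (i : ℕ) < k <;> simp [h]

/-- The prefix sub-cube has `2^{N-k}` points (`k ≤ N`). [folklore] -/
theorem card_prefixCube {k : ℕ} (hk : k ≤ N) (y : ℕ → Bool) : (prefixCube (N := N) k y).card = 2 ^ (N - k) := by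
  unfold prefixCube
  rw [Fintype.card_piFinset]
  have h : ∀ i : Fin N, (if (i : ℕ) < k then ({y i} : Finset Bool) else univ).card = if (i : ℕ) < k then 1 else 2 := by
    intro i; split_ifs <;> simp
  simp_rw [h]
  rw [Finset.prod_ite, Finset.prod_const_one, one_mul, Finset.prod_const]
  congr 1
  -- the coordinates `≥ k` are `N - k` many
  have hc : (univ.filter fun i : Fin N => ¬ (i : ℕ) < k) = univ.image (fun j : Fin (N - k) => (Fin.natAdd k j).cast (by omega)) := by
    ext i
    simp only [Finset.mem_filter, Finset.mem_univ, true_and, Finset.mem_image, not_lt]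
    constructor
    · intro hi
      refine ⟨⟨i - k, by omega⟩, ?_⟩
      ext; simp; omega
    · rintro ⟨j, rfl⟩
      simp
  rw [hc, Finset.card_image_of_injective _ (fun j j' h => by
    have := congrArg Fin.val h; simp at this; exact Fin.ext this), Finset.card_univ, Fintype.card_fin]

/-- The prefix sum (marginal) `S_y = Σ_{x ⊒ y} q(x)` of a real function over the points extending
the prefix `y↾k`. [cite: BremnerMontanaroShepherd2017, §3.1 (the sums S_y)] -/
def prefixSum (q : (Fin N → Bool) → ℝ) (k : ℕ) (y : ℕ → Bool) : ℝ := ∑ x ∈ prefixCube k y, q x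

/-- A character supported below `k` is constant on the prefix sub-cube. [folklore] -/
theorem walsh_eq_of_mem_prefixCube {k : ℕ} {y : ℕ → Bool} {S : Finset (Fin N)} (hS : ∀ i ∈ S, (i : ℕ) < k)
    {x : Fin N → Bool} (hx : x ∈ prefixCube k y) : walsh S x = ∏ i ∈ S, sgn (y i) := by
  unfold walsh
  refine Finset.prod_congr rfl fun i hi => ?_
  rw [mem_prefixCube.1 hx i (hS i hi)]

/-- Flipping one coordinate. [folklore] -/
def flipAt (j : Fin N) (x : Fin N → Bool) : Fin N → Bool := Function.update x j (!x j)

/-- Flipping twice is the identity. [folklore] -/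
@[simp] theorem flipAt_flipAt (j : Fin N) (x : Fin N → Bool) : flipAt j (flipAt j x) = x := by
  funext i
  unfold flipAt
  by_cases h : i = j
  · subst h; simp
  · simp [Function.update_of_ne h]

/-- A flip changes the point. [folklore] -/
theorem flipAt_ne (j : Fin N) (x : Fin N → Bool) : flipAt j x ≠ x := by
  intro h
  have := congrFun h j
  simp [flipAt] at this

/-- Flipping a coordinate inside `S` negates `χ_S`. [cite: ODonnell2014, §1.4] -/
theorem walsh_flipAt {S : Finset (Fin N)} {j : Fin N} (hj : j ∈ S) (x : Fin N → Bool) :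
    walsh S (flipAt j x) = -walsh S x := by
  unfold walsh
  rw [← Finset.mul_prod_erase S _ hj, ← Finset.mul_prod_erase S (fun i => sgn (x i)) hj]
  have h1 : sgn (flipAt j x j) = -sgn (x j) := by
    simp only [flipAt, Function.update_self]
    cases x j <;> simp [sgn]
  have h2 : ∏ i ∈ S.erase j, sgn (flipAt j x i) = ∏ i ∈ S.erase j, sgn (x i) := by
    refine Finset.prod_congr rfl fun i hi => ?_
    rw [Finset.mem_erase] at hi
    simp [flipAt, Function.update_of_ne hi.1]
  rw [h1, h2, neg_mul]

/-- A character *not* supported below `k` sums to zero over the prefix sub-cube (pair `x` with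
`x` flipped at a coordinate `j ∈ S`, `j ≥ k`). [cite: BremnerMontanaroShepherd2017, §3.1 (inner sum over x_{k+1..n})] -/
theorem sum_prefixCube_walsh_eq_zero {k : ℕ} {y : ℕ → Bool} {S : Finset (Fin N)} {j : Fin N}
    (hjS : j ∈ S) (hjk : k ≤ (j : ℕ)) : ∑ x ∈ prefixCube k y, walsh S x = 0 := by
  refine Finset.sum_involution (fun x _ => flipAt j x) ?_ ?_ ?_ ?_
  · intro x _
    rw [walsh_flipAt hjS, add_neg_cancel]
  · intro x _ _
    exact flipAt_ne j x
  · intro x hx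
    rw [mem_prefixCube] at hx ⊢
    intro i hi
    have hij : i ≠ j := by intro h; subst h; omega
    simp [flipAt, Function.update_of_ne hij, hx i hi]
  · intro x _
    exact flipAt_flipAt j x

/-- A character supported below `k` sums to `2^{N-k} χ_S(y)` over the prefix sub-cube.
[cite: BremnerMontanaroShepherd2017, §3.1] -/
theorem sum_prefixCube_walsh_eq {k : ℕ} (hk : k ≤ N) {y : ℕ → Bool} {S : Finset (Fin N)}
    (hS : ∀ i ∈ S, (i : ℕ) < k) : ∑ x ∈ prefixCube k y, walsh S x = 2 ^ (N - k) * ∏ i ∈ S, sgn (y i) := by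
  rw [Finset.sum_congr rfl (fun x hx => walsh_eq_of_mem_prefixCube hS hx), Finset.sum_const,
    card_prefixCube hk, nsmul_eq_mul]
  push_cast
  ring

/-- **Marginals of a Fourier-sparse function** (§3.1): for `q = Σ_S c_S χ_S` and a prefix `y↾k`,
`S_y = Σ_{x ⊒ y↾k} q(x) = 2^{N-k} Σ_{S ⊆ {0,…,k-1}} c_S χ_S(y)` — only the stored coefficients are
needed, so `S_y` is computable in time (number of nonzero `c_S`) · `poly`.
[cite: BremnerMontanaroShepherd2017, §3.1 (display for S_y)] -/
theorem prefixSum_fourierFn {k : ℕ} (hk : k ≤ N) (c : Finset (Fin N) → ℝ) (y : ℕ → Bool) :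
    prefixSum (fourierFn c) k y =
      2 ^ (N - k) * ∑ S ∈ univ.filter (fun S : Finset (Fin N) => ∀ i ∈ S, (i : ℕ) < k),
        c S * ∏ i ∈ S, sgn (y i) := by
  unfold prefixSum fourierFn
  rw [Finset.sum_comm, Finset.mul_sum, ← Finset.sum_filter_add_sum_filter_not univ
    (fun S : Finset (Fin N) => ∀ i ∈ S, (i : ℕ) < k)]
  have h0 : ∑ S ∈ univ.filter (fun S : Finset (Fin N) => ¬ ∀ i ∈ S, (i : ℕ) < k),
      ∑ x ∈ prefixCube k y, c S * walsh S x = 0 := by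
    refine Finset.sum_eq_zero fun S hS => ?_
    rw [Finset.mem_filter] at hS
    push Not at hS
    obtain ⟨j, hjS, hjk⟩ := hS.2
    rw [← Finset.mul_sum, sum_prefixCube_walsh_eq_zero hjS hjk, mul_zero]
  rw [h0, add_zero]
  refine Finset.sum_congr rfl fun S hS => ?_
  rw [Finset.mem_filter] at hS
  rw [← Finset.mul_sum, sum_prefixCube_walsh_eq hk hS.2]
  ring

/-- The whole cube is the prefix sub-cube of the empty prefix: `S_∅ = Σ_x q(x)`. [folklore] -/
theorem prefixSum_zero (q : (Fin N → Bool) → ℝ) (y : ℕ → Bool) : prefixSum q 0 y = ∑ x, q x := by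
  unfold prefixSum
  refine Finset.sum_congr ?_ fun _ _ => rfl
  ext x
  simp [mem_prefixCube]

/-- Splitting a prefix sum on the next bit: `S_y = S_{y0} + S_{y1}` (`k < N`).
[cite: BremnerMontanaroShepherd2017, §3.2 ("we would have S_y < 0" uses S_y = S_{y0} + S_{y1})] -/
theorem prefixSum_succ_split (q : (Fin N → Bool) → ℝ) {k : ℕ} (hk : k < N) (y : ℕ → Bool) :
    prefixSum q k y = prefixSum q (k + 1) (Function.update y k false) +
      prefixSum q (k + 1) (Function.update y k true) := by
  unfold prefixSum
  rw [← Finset.sum_union]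
  · congr 1
    ext x
    simp only [Finset.mem_union, mem_prefixCube]
    constructor
    · intro hx
      cases hxk : x ⟨k, hk⟩
      · left
        intro i hi
        by_cases hik : (i : ℕ) = k
        · have : i = ⟨k, hk⟩ := Fin.ext hik
          subst this
          simp [hxk]
        · rw [Function.update_of_ne hik]
          exact hx i (by omega)
      · right
        intro i hi
        by_cases hik : (i : ℕ) = k
        · have : i = ⟨k, hk⟩ := Fin.ext hik
          subst this
          simp [hxk]
        · rw [Function.update_of_ne hik]
          exact hx i (by omega)
    · rintro (hx | hx) <;> intro i hi
      · have h := hx i (by omega)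
        rwa [Function.update_of_ne (by omega : (i : ℕ) ≠ k)] at h
      · have h := hx i (by omega)
        rwa [Function.update_of_ne (by omega : (i : ℕ) ≠ k)] at h
  · rw [Finset.disjoint_left]
    intro x h0 h1
    rw [mem_prefixCube] at h0 h1
    have a := h0 ⟨k, hk⟩ (by simp)
    have b := h1 ⟨k, hk⟩ (by simp)
    simp at a b
    rw [a] at b
    exact Bool.false_ne_true b

/-- The full prefix pins the point: `S_y = q(y)` for `k = N`. [folklore] -/
theorem prefixSum_self (q : (Fin N → Bool) → ℝ) (y : ℕ → Bool) :
    prefixSum q N y = q (fun i => y i) := by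
  unfold prefixSum
  rw [Finset.sum_eq_single_of_mem (fun i : Fin N => y i)]
  · rw [mem_prefixCube]; intro i _; rfl
  · intro x hx hne
    exfalso; apply hne
    funext i
    exact mem_prefixCube.1 hx i i.2

end Literature.Barriers.QuantumAdvantage

end
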